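import Literature.Analysis.FluidPDE.NSCriticalClosureBesovHolds
import Literature.Analysis.FluidPDE.LerayHopfFinalTimeDistribution
import Summits.NavierStokesRegularity.NavierStokesRegularity.Theses.CertifiedBlowup
import HarnessLib

/-!
# Witnesses of the crux `CertifiedBlowupAxisymBlowup`: the critical Besov norms `Ḃ^{-1+3/r}_{r,q}` blow up

Theorems file landed `--supports stmt-NavierStokesRegularity-0727`, line `compact-amplification`
(continuation lead c3, wave 2; registered stub `iSup_eHomBesovNorm_eq_top_of_isMaximalSmoothSolution`).
The crux asks for a viscosity `ν > 0`, a time `T > 0` and a maximal smooth solution `(u, p)` of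
lifespan `T`, Leray–Hopf on `[0, T]` from its rapidly decaying axisymmetric datum `u 0`. This file
proves, for an ARBITRARY such witness `(ν, T, u, p)` and using only PROVED theorems of the tree:

* `iSup_eHomBesovNorm_eq_top_of_isMaximalSmoothSolution` (registered): **Gallagher–Koch–Planchon's
  critical Besov blow-up** — for every family `U t` of tempered-distribution representatives of the
  slices `u t`, `0 ≤ t < T`, and all exponents `3 < r < ∞`, `3 < q < ∞`,
  `sup_{0 ≤ t < T} ‖U t‖_{Ḃ^{-1+3/r}_{r,q}} = ∞` (Gallagher–Koch–Planchon 2016, Thm. 1;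
  Albritton 2018, Thm. 1.3), by maximality against the tree's DISCHARGED continuation criterion
  `hasSmoothExtensionPast_of_eHomBesovNorm_bounded_holds` (`NSCriticalClosureBesovHolds.lean`);
* `exists_forall_isDistributionOf_of_lerayHopf`: the statement is not vacuous — every slice
  `u t`, `t ∈ [0, T]`, of a Leray–Hopf solution is an `L²` field and hence HAS a tempered
  distribution (`L² ⊂ 𝓢'`, Bahouri–Chemin–Danchin 2011, §1.2);
* `exists_isDistributionOf_iSup_eHomBesovNorm_eq_top_of_isMaximalSmoothSolution`: the two combined
  — every witness carries representatives `U` of its slices on `[0, T)` with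
  `sup_{0 ≤ t < T} ‖U t‖_{Ḃ^{-1+3/r}_{r,q}} = ∞` for all `3 < r, q < ∞`.

This extends the wave-1 `L³` statement (`…AxisymBlowupL3Blowup.lean`) to the whole critical
Besov scale `Ḃ^{-1+3/r}_{r,q} ⊃ L³`, `3 < r, q < ∞`: the constraint every certification of the
crux must respect.

No new definitions, no named-fact hypotheses, no `sorry`.

## References

* I. Gallagher, G. S. Koch, F. Planchon, *Blow-up of critical Besov norms at a potential
  Navier–Stokes singularity*, Comm. Math. Phys. 343 (2016), 39–82, Thm. 1. [GallagherKochPlanchon2016]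
  [GKP2016]
* D. Albritton, *Blow-up criteria for the Navier–Stokes equations in non-endpoint critical Besov
  spaces*, Anal. PDE 11 (2018), 1415–1456, Thm. 1.3. [Albritton2018]
* H. Bahouri, J.-Y. Chemin, R. Danchin, *Fourier Analysis and Nonlinear Partial Differential
  Equations*, Springer 2011, §1.2 and Def. 2.15. [BahouriCheminDanchin2011]
-/

-- the summit and its single problem share the name (D-0017 nested layout)
set_option linter.dupNamespace false

noncomputable section

open MeasureTheory Set Function Filter Topology Metric
open scoped ENNReal NNReal

namespace Summit.NavierStokesRegularity.NavierStokesRegularity.Theorems.CertifiedBlowupAxisymBlowup.CompactAmplification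

open Literature.Analysis.FluidPDE

section Witness

variable {ν T : ℝ} {u : ℝ → (EuclideanSpace ℝ (Fin 3)) → (EuclideanSpace ℝ (Fin 3))} {p : ℝ → (EuclideanSpace ℝ (Fin 3)) → ℝ}

/-- **`sup_{0 ≤ t < T} ‖U t‖_{Ḃ^{-1+3/r}_{r,q}} = ∞` for the crux's class** (Gallagher–Koch–Planchon
2016, Thm. 1, in the tree's continuation form `hasSmoothExtensionPast_of_eHomBesovNorm_bounded_holds`):
along a maximal Leray–Hopf classical solution of finite lifespan `T > 0` from a rapidly decaying
datum, for every family `U t` of tempered distributions representing the slices `u t` on `[0, T)`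
and all `3 < r < ∞`, `3 < q < ∞`, a bounded critical Besov norm on `[0, T)` would continue the
solution smoothly past `T`, contradicting maximality. [cite: GallagherKochPlanchon2016, Thm. 1] -/
theorem iSup_eHomBesovNorm_eq_top_of_isMaximalSmoothSolution' (hν : 0 < ν) (hT : 0 < T)
    (hmax : IsMaximalSmoothSolution ν 0 u p T) (hLH : IsLerayHopfOn T ν 0 (u 0) u)
    (hdec : HasRapidSpatialDecay (u 0))
    (U : ℝ → TemperedDistribution (EuclideanSpace ℝ (Fin 3)) (EuclideanSpace ℂ (Fin 3)))
    (r q : ℝ≥0∞) [Fact (1 ≤ r)] (hr3 : 3 < r) (hr : r < ⊤) (hq3 : 3 < q) (hq : q < ⊤)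
    (hU : ∀ t ∈ Ico 0 T, IsDistributionOf (u t) (U t)) :
    (⨆ t ∈ Ico 0 T,
      Literature.Analysis.FunctionSpaces.eHomBesovNorm (-1 + 3 / r.toReal) r q (U t)) = ⊤ := by
  by_contra hne
  exact hmax.2 (hasSmoothExtensionPast_of_eHomBesovNorm_bounded_holds ν T hν hT u p U r q hr3 hr
    hq3 hq hmax.1 hLH hdec hU (lt_top_iff_ne_top.2 hne))

/-- **Every slice of a Leray–Hopf solution has a tempered distribution** (`L² ⊂ 𝓢'`,
Bahouri–Chemin–Danchin 2011, §1.2): for `IsLerayHopfOn T ν 0 (u 0) u` every slice `u t`,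
`t ∈ [0, T]`, is an `L²` field (`IsLerayHopfOn.memLp`), hence is represented by a tempered
distribution (`exists_isDistributionOf_of_memLp`); choosing one for each `t` gives a family `U`
with `IsDistributionOf (u t) (U t)` on `[0, T]`. [cite: BahouriCheminDanchin2011, §1.2] -/
theorem exists_forall_isDistributionOf_of_lerayHopf (hLH : IsLerayHopfOn T ν 0 (u 0) u) :
    ∃ U : ℝ → TemperedDistribution (EuclideanSpace ℝ (Fin 3)) (EuclideanSpace ℂ (Fin 3)),
      ∀ t ∈ Icc 0 T, IsDistributionOf (u t) (U t) := by
  haveI : Fact ((1 : ℝ≥0∞) ≤ 2) := ⟨by norm_num⟩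
  have h : ∀ t : ℝ, ∃ Ut : TemperedDistribution (EuclideanSpace ℝ (Fin 3)) (EuclideanSpace ℂ (Fin 3)),
      t ∈ Icc 0 T → IsDistributionOf (u t) Ut := by
    intro t
    by_cases ht : t ∈ Icc 0 T
    · obtain ⟨Ut, hUt⟩ := exists_isDistributionOf_of_memLp (p := 2) (hLH.memLp t ht)
      exact ⟨Ut, fun _ => hUt⟩
    · exact ⟨0, fun h => absurd h ht⟩
  choose U hU using h
  exact ⟨U, hU⟩

/-- **Non-vacuous form of the critical Besov blow-up** (Gallagher–Koch–Planchon 2016, Thm. 1;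
Albritton 2018, Thm. 1.3): every maximal Leray–Hopf classical solution of finite lifespan `T > 0`
from a rapidly decaying datum carries a family `U` of tempered distributions representing its slices
on `[0, T)` (`exists_forall_isDistributionOf_of_lerayHopf`), and for it
`sup_{0 ≤ t < T} ‖U t‖_{Ḃ^{-1+3/r}_{r,q}} = ∞` for all `3 < r < ∞`, `3 < q < ∞`.
[cite: Albritton2018, Thm. 1.3] -/
theorem exists_isDistributionOf_iSup_eHomBesovNorm_eq_top_of_isMaximalSmoothSolution (hν : 0 < ν)
    (hT : 0 < T) (hmax : IsMaximalSmoothSolution ν 0 u p T) (hLH : IsLerayHopfOn T ν 0 (u 0) u)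
    (hdec : HasRapidSpatialDecay (u 0)) :
    ∃ U : ℝ → TemperedDistribution (EuclideanSpace ℝ (Fin 3)) (EuclideanSpace ℂ (Fin 3)),
      (∀ t ∈ Ico 0 T, IsDistributionOf (u t) (U t)) ∧
        ∀ (r q : ℝ≥0∞) [Fact (1 ≤ r)], 3 < r → r < ⊤ → 3 < q → q < ⊤ →
          (⨆ t ∈ Ico 0 T,
            Literature.Analysis.FunctionSpaces.eHomBesovNorm (-1 + 3 / r.toReal) r q (U t)) = ⊤ := by
  obtain ⟨U, hU⟩ := exists_forall_isDistributionOf_of_lerayHopf hLH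
  have hU' : ∀ t ∈ Ico 0 T, IsDistributionOf (u t) (U t) := fun t ht => hU t (Ico_subset_Icc_self ht)
  refine ⟨U, hU', ?_⟩
  intro r q _ hr3 hr hq3 hq
  exact iSup_eHomBesovNorm_eq_top_of_isMaximalSmoothSolution' hν hT hmax hLH hdec U r q hr3 hr
    hq3 hq hU'

end Witness

/-- **Gallagher–Koch–Planchon's critical Besov blow-up at the crux** (registered stub of
stmt-NavierStokesRegularity-0727): for every witness `(ν, T, u, p)` of `CertifiedBlowupAxisymBlowup`
— a maximal Leray–Hopf classical solution of finite lifespan `T > 0`, viscosity `ν > 0`, from a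
rapidly decaying axisymmetric datum — every family `U t` of tempered-distribution representatives of
the slices `u t`, `0 ≤ t < T`, has `sup_{0 ≤ t < T} ‖U t‖_{Ḃ^{-1+3/r}_{r,q}} = ∞` for all
`3 < r < ∞`, `3 < q < ∞` (Gallagher–Koch–Planchon 2016, Thm. 1; Albritton 2018, Thm. 1.3: even
`lim_{t ↑ T} = ∞`), the contrapositive of the tree's discharged continuation criterion
`hasSmoothExtensionPast_of_eHomBesovNorm_bounded_holds` against maximality. The axisymmetry of the
datum is not needed. [cite: GallagherKochPlanchon2016, Thm. 1] -/
theorem iSup_eHomBesovNorm_eq_top_of_isMaximalSmoothSolution : ∀ {ν T : ℝ} {u : ℝ → EuclideanSpace ℝ (Fin 3) → EuclideanSpace ℝ (Fin 3)} {p : ℝ → EuclideanSpace ℝ (Fin 3) → ℝ}, 0 < ν → 0 < T → IsMaximalSmoothSolution ν 0 u p T → IsLerayHopfOn T ν 0 (u 0) u → HasRapidSpatialDecay (u 0) → IsAxisymmetric (u 0) → ∀ (U : ℝ → TemperedDistribution (EuclideanSpace ℝ (Fin 3)) (EuclideanSpace ℂ (Fin 3))) (r q : ENNReal) [Fact (1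 ≤ r)], 3 < r → r < ⊤ → 3 < q → q < ⊤ → (∀ t ∈ Set.Ico 0 T, IsDistributionOf (u t) (U t)) → (⨆ t ∈ Set.Ico 0 T, Literature.Analysis.FunctionSpaces.eHomBesovNorm (-1 + 3 / r.toReal) r q (U t)) = ⊤ := by
  intro ν T u p hν hT hmax hLH hdec _ U r q _ hr3 hr hq3 hq hU
  exact iSup_eHomBesovNorm_eq_top_of_isMaximalSmoothSolution' hν hT hmax hLH hdec U r q hr3 hr hq3
    hq hU

end Summit.NavierStokesRegularity.NavierStokesRegularity.Theorems.CertifiedBlowupAxisymBlowup.CompactAmplification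

end
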